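import Summits.KontsevichZagierPeriods.KontsevichZagierPeriods.Theorems.HeckeMultiplicityOneManinStokesJacobian
import Summits.KontsevichZagierPeriods.KontsevichZagierPeriods.Theorems.HeckeMultiplicityOneManinStokesSemialgebraic
import Summits.KontsevichZagierPeriods.KontsevichZagierPeriods.Theorems.HeckeMultiplicityOneManinStokesTileEdgeB
import Summits.KontsevichZagierPeriods.KontsevichZagierPeriods.Theorems.HeckeMultiplicityOneManinStokesTileIntegrand
import Summits.KontsevichZagierPeriods.KontsevichZagierPeriods.Theorems.HeckeMultiplicityOneManinStokesHalfPlaneCauchy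
import Summits.KontsevichZagierPeriods.KontsevichZagierPeriods.Theorems.HeckeMultiplicityOneManinStokesReflect
import Summits.KontsevichZagierPeriods.KontsevichZagierPeriods.Theorems.HeckeMultiplicityOneManinStokesReduction
import Summits.KontsevichZagierPeriods.KontsevichZagierPeriods.Theorems.HeckeMultiplicityOneManinStokesTileDecay

/-!
# `ManinStokes` (stmt-KontsevichZagierPeriods-5277): Manin's three-term relation in the KZ period algebra

Support file (prover-owned, `--supports stmt-KontsevichZagierPeriods-5277`; the item is informal-only in the
route file, this proves the typed form proposed in the evidence note `ManinStokes-typed.md`). Assembly of the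
programme: Cauchy's theorem for the `(2,3,∞)`-tile `τ₀` in the algebraic coordinate `u = j`, written as three
edge representations summing to an element of `KZ.relations` (`tile_cauchy_re/im`, from
`cauchy_three_edges_re/im` with every analytic hypothesis discharged for `G = (ω/dj)(f ∣ h) ∘ ψ`:
`…TileInverse`, `…TileDecay`, `…Semialgebraic`, `…Jacobian`, `…TileEdgeB`, `…TileIntegrand`), the mirror
tiles by the reflection `z ↦ −z̄` (`mirror_tile_cauchy_re/im`, `…Reflect`), and the barycentric reduction
(`classRe/classIm_three_term_of_tiles`, `…Reduction`) give `maninStokes`: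
for `f ∈ S₂(Γ₀(N))` with rational coefficients, `g ∈ SL₂(ℤ)`, `R = TS` and modular-symbol representations
`ρ₀, ρ₁, ρ₂` of `⟨g⟩, ⟨gR⟩, ⟨gR²⟩`, both `Σ ρᵢ.classRe` and `Σ ρᵢ.classIm` lie in `KZ.relations`.

References: Yu. I. Manin, *Parabolic points and zeta functions of modular curves* (1972), §1.6;
M. Kontsevich, D. Zagier, *Periods* (2001), §1.2, §3.4. No definitions, no named facts.
-/

noncomputable section

namespace Summit.KontsevichZagierPeriods.HeckeMultiplicityOne.ManinStokes

/-! ### The edges of the mirror tile -/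

section MirrorEdges

open scoped MatrixGroups ModularForm Modular Manifold Topology
open MeasureTheory
open CongruenceSubgroup Complex Set Filter
open UpperHalfPlane hiding I
open Literature.NumberTheory.EllipticCurves Literature.NumberTheory.EllipticCurves.ModularForms
open ModularForm

variable {ψ : ℂ → ℍ}

/-- **On the arc `B`** (`0 < u < 1728`): `S · ψ(u) = −conj ψ(u)` (`ψ(u) = e^{iθ}` has norm `1`). [folklore] -/
theorem S_smul_tileInv_of_mem_Ioo
    (hψ : ∀ u : ℂ, u.im ≤ 0 → ψ u ∈ {z : ℍ | z ∈ 𝒟 ∧ 0 ≤ z.re} ∧ kleinJ (ψ u) = u)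
    {u : ℝ} (hu : u ∈ Ioo (0 : ℝ) 1728) : ModularGroup.S • ψ (u : ℂ) = negConjPt (ψ (u : ℂ)) := by
  have hu' : u ∈ (fun θ : ℝ => (kleinJ (ofComplex (Complex.exp (θ * I)))).re) '' Ioo (Real.pi / 3) (Real.pi / 2) := by
    rw [image_kleinJ_ofComplex_exp_re_Ioo]; exact hu
  obtain ⟨θ, hθ, rfl⟩ := hu'
  have hθ' : θ ∈ Icc (Real.pi / 3) (Real.pi / 2) := Ioo_subset_Icc_self hθ
  obtain ⟨h0, hπ⟩ := pos_and_lt_pi_of_mem_Icc hθ'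
  rw [tileInv_kleinJ_ofComplex_exp hψ hθ']
  exact S_smul_eq_negConjPt_of_norm_eq_one (norm_coe_ofComplex_exp h0 hπ)

/-- **On the line `C`** (`u < 0`): `T⁻¹ · ψ(u) = −conj ψ(u)` (`ψ(u) = 1/2 + it`). [folklore] -/
theorem T_inv_smul_tileInv_of_neg
    (hψ : ∀ u : ℂ, u.im ≤ 0 → ψ u ∈ {z : ℍ | z ∈ 𝒟 ∧ 0 ≤ z.re} ∧ kleinJ (ψ u) = u)
    {u : ℝ} (hu : u < 0) : ModularGroup.T⁻¹ • ψ (u : ℂ) = negConjPt (ψ (u : ℂ)) := by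
  have hu' : u ∈ (fun t : ℝ => (kleinJ (ofComplex ((1 / 2 : ℂ) + t * I))).re) '' Ioi (Real.sqrt 3 / 2) := by
    rw [image_kleinJ_ofComplex_half_re_Ioi]; exact hu
  obtain ⟨t, ht, rfl⟩ := hu'
  have ht0 : 0 < t := lt_trans (by positivity) ht
  rw [tileInv_kleinJ_ofComplex_half hψ (le_of_lt ht)]
  exact T_inv_smul_ofComplex_half ht0

end MirrorEdges

/-! ## Cauchy's theorem for the tile `τ₀` inside the calculus, and Manin's three-term relation

Assembly: for `φ = f ∣ h` (`f` with rational coefficients, `h ∈ SL₂(ℤ)`) the function `G = (ω/dj)(φ) ∘ ψ`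
satisfies every hypothesis of `cauchy_three_edges_re/im` (continuity, holomorphy, decay, semialgebraicity,
integrability of `G'` on the lower half plane, integrability on the three edges), giving the per-tile
relations `[A] + [B] + [C] ∈ KZ.relations` in the shape consumed by `three_term_of_tiles`; the mirror tiles
follow from the reflection `z ↦ −z̄` (`h ↦ h^ε`), and the three-term relation for `classRe`, `classIm`
follows from `classRe/classIm_three_term_of_tiles`. -/

section Assembly

open scoped MatrixGroups ModularForm Modular Manifold Topology
open MeasureTheory
open CongruenceSubgroup Complex Set Filter
open UpperHalfPlane hiding I
open Literature.NumberTheory.EllipticCurves Literature.NumberTheory.EllipticCurves.ModularForms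
open ModularForm
open Literature.NumberTheory.Transcendental Literature.NumberTheory.Transcendental.KZ

variable {N : ℕ} [NeZero N] {ψ : ℂ → ℍ}

/-- **Cauchy's theorem for the tile `τ₀` in the coordinate `u = j`, real parts**: for `φ = f ∣ h` the
three edge representations `[(1728,∞), re (ω/dj)(ψ u)]`, `[(0,1728), re (ω/dj)(ψ u)]`,
`[(−∞,0), re (ω/dj)(ψ u)]` sum to an element of `KZ.relations` (value `re ∮_{∂τ₀} ω = 0`).
[cite: KontsevichZagierPeriods2001, §1.2 rules (1)–(3), §3.4] -/
theorem tile_cauchy_re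
    (hψ : ∀ u : ℂ, u.im ≤ 0 → ψ u ∈ {z : ℍ | z ∈ 𝒟 ∧ 0 ≤ z.re} ∧ kleinJ (ψ u) = u)
    (f : CuspForm (Gamma0 N) 2) (hf : HasRatCoeffs f) (h : SL(2, ℤ)) :
    ∃ a b c : IntegralRep 1,
      a.domain = arcDomain ∧
      EqOn a.integrand (fun x => (arcIntegrand (⇑f ∣[(2 : ℤ)] h) (x 0)).re) arcDomain ∧
      b.domain = {x | x 0 ∈ Ioo (0 : ℝ) 1728} ∧
      EqOn b.integrand (fun x => (djQuot (⇑f ∣[(2 : ℤ)] h) (ψ (x 0))).re) {x | x 0 ∈ Ioo (0 : ℝ) 1728} ∧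
      c.domain = {x | x 0 < 0} ∧
      EqOn c.integrand (fun x => (djQuot (⇑f ∣[(2 : ℤ)] h) (ψ (x 0))).re) {x | x 0 < 0} ∧
      KZ.of a + KZ.of b + KZ.of c ∈ KZ.relations := by
  have hφ : IsCuspFunction N (⇑f ∣[(2 : ℤ)] h) := isCuspFunction_slash f h
  obtain ⟨hGre, hGim⟩ := isSemialgebraicFunOn_reIm_djQuot_tileInv hψ f hf h
  have hIA : IntegrableOn (fun x : Fin 1 → ℝ => djQuot (⇑f ∣[(2 : ℤ)] h) (ψ (x 0))) {x | 1728 < x 0} := by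
    refine hφ.integrableOn_arcIntegrand.congr_fun (fun x hx => ?_)
      (measurableSet_lt measurable_const (measurable_pi_apply 0))
    show arcIntegrand _ (x 0) = djQuot _ (ψ (x 0))
    rw [arcIntegrand, tileInv_of_gt hψ hx]
  obtain ⟨a, b, c, ha, hai, hb, hbi, hc, hci, hrel⟩ :=
    cauchy_three_edges_re (G := fun u => djQuot (⇑f ∣[(2 : ℤ)] h) (ψ u))
      (continuousOn_djQuot_tileInv hψ hφ.mdifferentiable) (differentiableOn_djQuot_tileInv hψ hφ.mdifferentiable)
      (djQuot_tileInv_decay hψ hφ) hGre hGim (integrableOn_deriv_djQuot_tileInv hψ hφ) hIA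
      (integrableOn_djQuot_tileInv_B hψ hφ.mdifferentiable) (integrableOn_djQuot_tileInv_C hψ hφ)
  refine ⟨a, b, c, ha, fun x hx => ?_, hb, hbi, hc, hci, hrel⟩
  rw [hai hx]
  show (djQuot _ (ψ (x 0))).re = (arcIntegrand _ (x 0)).re
  rw [arcIntegrand, tileInv_of_gt hψ hx]

/-- **Cauchy's theorem for the tile `τ₀` in the coordinate `u = j`, imaginary parts.**
[cite: KontsevichZagierPeriods2001, §1.2 rules (1)–(3), §3.4] -/
theorem tile_cauchy_im
    (hψ : ∀ u : ℂ, u.im ≤ 0 → ψ u ∈ {z : ℍ | z ∈ 𝒟 ∧ 0 ≤ z.re} ∧ kleinJ (ψ u) = u)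
    (f : CuspForm (Gamma0 N) 2) (hf : HasRatCoeffs f) (h : SL(2, ℤ)) :
    ∃ a b c : IntegralRep 1,
      a.domain = arcDomain ∧
      EqOn a.integrand (fun x => (arcIntegrand (⇑f ∣[(2 : ℤ)] h) (x 0)).im) arcDomain ∧
      b.domain = {x | x 0 ∈ Ioo (0 : ℝ) 1728} ∧
      EqOn b.integrand (fun x => (djQuot (⇑f ∣[(2 : ℤ)] h) (ψ (x 0))).im) {x | x 0 ∈ Ioo (0 : ℝ) 1728} ∧
      c.domain = {x | x 0 < 0} ∧
      EqOn c.integrand (fun x => (djQuot (⇑f ∣[(2 : ℤ)] h) (ψ (x 0))).im) {x | x 0 < 0} ∧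
      KZ.of a + KZ.of b + KZ.of c ∈ KZ.relations := by
  have hφ : IsCuspFunction N (⇑f ∣[(2 : ℤ)] h) := isCuspFunction_slash f h
  obtain ⟨hGre, hGim⟩ := isSemialgebraicFunOn_reIm_djQuot_tileInv hψ f hf h
  have hIA : IntegrableOn (fun x : Fin 1 → ℝ => djQuot (⇑f ∣[(2 : ℤ)] h) (ψ (x 0))) {x | 1728 < x 0} := by
    refine hφ.integrableOn_arcIntegrand.congr_fun (fun x hx => ?_)
      (measurableSet_lt measurable_const (measurable_pi_apply 0))
    show arcIntegrand _ (x 0) = djQuot _ (ψ (x 0))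
    rw [arcIntegrand, tileInv_of_gt hψ hx]
  obtain ⟨a, b, c, ha, hai, hb, hbi, hc, hci, hrel⟩ :=
    cauchy_three_edges_im (G := fun u => djQuot (⇑f ∣[(2 : ℤ)] h) (ψ u))
      (continuousOn_djQuot_tileInv hψ hφ.mdifferentiable) (differentiableOn_djQuot_tileInv hψ hφ.mdifferentiable)
      (djQuot_tileInv_decay hψ hφ) hGre hGim (integrableOn_deriv_djQuot_tileInv hψ hφ) hIA
      (integrableOn_djQuot_tileInv_B hψ hφ.mdifferentiable) (integrableOn_djQuot_tileInv_C hψ hφ)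
  refine ⟨a, b, c, ha, fun x hx => ?_, hb, hbi, hc, hci, hrel⟩
  rw [hai hx]
  show (djQuot _ (ψ (x 0))).im = (arcIntegrand _ (x 0)).im
  rw [arcIntegrand, tileInv_of_gt hψ hx]

/-- **Cauchy's theorem for the tile `τ₀`, negated imaginary parts** (for the mirror tiles).
[cite: KontsevichZagierPeriods2001, §1.2 rules (1)–(3), §3.4] -/
theorem tile_cauchy_neg_im
    (hψ : ∀ u : ℂ, u.im ≤ 0 → ψ u ∈ {z : ℍ | z ∈ 𝒟 ∧ 0 ≤ z.re} ∧ kleinJ (ψ u) = u)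
    (f : CuspForm (Gamma0 N) 2) (hf : HasRatCoeffs f) (h : SL(2, ℤ)) :
    ∃ a b c : IntegralRep 1,
      a.domain = arcDomain ∧
      EqOn a.integrand (fun x => -(arcIntegrand (⇑f ∣[(2 : ℤ)] h) (x 0)).im) arcDomain ∧
      b.domain = {x | x 0 ∈ Ioo (0 : ℝ) 1728} ∧
      EqOn b.integrand (fun x => -(djQuot (⇑f ∣[(2 : ℤ)] h) (ψ (x 0))).im) {x | x 0 ∈ Ioo (0 : ℝ) 1728} ∧
      c.domain = {x | x 0 < 0} ∧
      EqOn c.integrand (fun x => -(djQuot (⇑f ∣[(2 : ℤ)] h) (ψ (x 0))).im) {x | x 0 < 0} ∧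
      KZ.of a + KZ.of b + KZ.of c ∈ KZ.relations := by
  have hφ : IsCuspFunction N (⇑f ∣[(2 : ℤ)] h) := isCuspFunction_slash f h
  obtain ⟨hGre, hGim⟩ := isSemialgebraicFunOn_reIm_djQuot_tileInv hψ f hf h
  have hIA : IntegrableOn (fun x : Fin 1 → ℝ => djQuot (⇑f ∣[(2 : ℤ)] h) (ψ (x 0))) {x | 1728 < x 0} := by
    refine hφ.integrableOn_arcIntegrand.congr_fun (fun x hx => ?_)
      (measurableSet_lt measurable_const (measurable_pi_apply 0))
    show arcIntegrand _ (x 0) = djQuot _ (ψ (x 0))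
    rw [arcIntegrand, tileInv_of_gt hψ hx]
  obtain ⟨a, b, c, ha, hai, hb, hbi, hc, hci, hrel⟩ :=
    cauchy_three_edges_neg_im (G := fun u => djQuot (⇑f ∣[(2 : ℤ)] h) (ψ u))
      (continuousOn_djQuot_tileInv hψ hφ.mdifferentiable) (differentiableOn_djQuot_tileInv hψ hφ.mdifferentiable)
      (djQuot_tileInv_decay hψ hφ) hGre hGim (integrableOn_deriv_djQuot_tileInv hψ hφ) hIA
      (integrableOn_djQuot_tileInv_B hψ hφ.mdifferentiable) (integrableOn_djQuot_tileInv_C hψ hφ)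
  refine ⟨a, b, c, ha, fun x hx => ?_, hb, hbi, hc, hci, hrel⟩
  rw [hai hx]
  show -(djQuot _ (ψ (x 0))).im = -(arcIntegrand _ (x 0)).im
  rw [arcIntegrand, tileInv_of_gt hψ hx]

/-- **The mirror tile `τ₀*`, real parts**: the edge representations of `h` along `S·ψ`, `T⁻¹·ψ` are those of
`h^ε` along `ψ` (conjugate integrands have equal real parts). [cite: CremonaAlgorithms1997, §2.8] -/
theorem mirror_tile_cauchy_re
    (hψ : ∀ u : ℂ, u.im ≤ 0 → ψ u ∈ {z : ℍ | z ∈ 𝒟 ∧ 0 ≤ z.re} ∧ kleinJ (ψ u) = u)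
    (f : CuspForm (Gamma0 N) 2) (hf : HasRatCoeffs f) (h : SL(2, ℤ)) :
    ∃ a b c : IntegralRep 1,
      a.domain = arcDomain ∧
      EqOn a.integrand (fun x => (arcIntegrand (⇑f ∣[(2 : ℤ)] h) (x 0)).re) arcDomain ∧
      b.domain = {x | x 0 ∈ Ioo (0 : ℝ) 1728} ∧
      EqOn b.integrand (fun x => (djQuot (⇑f ∣[(2 : ℤ)] h)
        (ModularGroup.S • (fun t : ℝ => ψ (t : ℂ)) (x 0))).re) {x | x 0 ∈ Ioo (0 : ℝ) 1728} ∧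
      c.domain = {x | x 0 < 0} ∧
      EqOn c.integrand (fun x => (djQuot (⇑f ∣[(2 : ℤ)] h)
        (ModularGroup.T⁻¹ • (fun t : ℝ => ψ (t : ℂ)) (x 0))).re) {x | x 0 < 0} ∧
      KZ.of a + KZ.of b + KZ.of c ∈ KZ.relations := by
  have hf' := hf.conj_coeff
  obtain ⟨a, b, c, ha, hai, hb, hbi, hc, hci, hrel⟩ := tile_cauchy_re hψ f hf (reflect h)
  refine ⟨a, b, c, ha, fun x hx => ?_, hb, fun x hx => ?_, hc, fun x hx => ?_, hrel⟩
  · rw [hai hx]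
    show (arcIntegrand _ (x 0)).re = (arcIntegrand _ (x 0)).re
    rw [arcIntegrand_eq_conj_reflect f hf' h hx, Complex.conj_re]
  · rw [hbi hx]
    show (djQuot _ (ψ (x 0))).re = (djQuot _ (ModularGroup.S • ψ (x 0))).re
    rw [S_smul_tileInv_of_mem_Ioo hψ hx, djQuot_slash_negConjPt f hf' h, Complex.conj_re]
  · rw [hci hx]
    show (djQuot _ (ψ (x 0))).re = (djQuot _ (ModularGroup.T⁻¹ • ψ (x 0))).re
    rw [T_inv_smul_tileInv_of_neg hψ hx, djQuot_slash_negConjPt f hf' h, Complex.conj_re]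

/-- **The mirror tile `τ₀*`, imaginary parts** (conjugate integrands have opposite imaginary parts:
use `tile_cauchy_neg_im` for `h^ε`). [cite: CremonaAlgorithms1997, §2.8] -/
theorem mirror_tile_cauchy_im
    (hψ : ∀ u : ℂ, u.im ≤ 0 → ψ u ∈ {z : ℍ | z ∈ 𝒟 ∧ 0 ≤ z.re} ∧ kleinJ (ψ u) = u)
    (f : CuspForm (Gamma0 N) 2) (hf : HasRatCoeffs f) (h : SL(2, ℤ)) :
    ∃ a b c : IntegralRep 1,
      a.domain = arcDomain ∧
      EqOn a.integrand (fun x => (arcIntegrand (⇑f ∣[(2 : ℤ)] h) (x 0)).im) arcDomain ∧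
      b.domain = {x | x 0 ∈ Ioo (0 : ℝ) 1728} ∧
      EqOn b.integrand (fun x => (djQuot (⇑f ∣[(2 : ℤ)] h)
        (ModularGroup.S • (fun t : ℝ => ψ (t : ℂ)) (x 0))).im) {x | x 0 ∈ Ioo (0 : ℝ) 1728} ∧
      c.domain = {x | x 0 < 0} ∧
      EqOn c.integrand (fun x => (djQuot (⇑f ∣[(2 : ℤ)] h)
        (ModularGroup.T⁻¹ • (fun t : ℝ => ψ (t : ℂ)) (x 0))).im) {x | x 0 < 0} ∧
      KZ.of a + KZ.of b + KZ.of c ∈ KZ.relations := by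
  have hf' := hf.conj_coeff
  obtain ⟨a, b, c, ha, hai, hb, hbi, hc, hci, hrel⟩ := tile_cauchy_neg_im hψ f hf (reflect h)
  refine ⟨a, b, c, ha, fun x hx => ?_, hb, fun x hx => ?_, hc, fun x hx => ?_, hrel⟩
  · rw [hai hx]
    show -(arcIntegrand _ (x 0)).im = (arcIntegrand _ (x 0)).im
    rw [arcIntegrand_eq_conj_reflect f hf' h hx, Complex.conj_im]
  · rw [hbi hx]
    show -(djQuot _ (ψ (x 0))).im = (djQuot _ (ModularGroup.S • ψ (x 0))).im
    rw [S_smul_tileInv_of_mem_Ioo hψ hx, djQuot_slash_negConjPt f hf' h, Complex.conj_im]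
  · rw [hci hx]
    show -(djQuot _ (ψ (x 0))).im = (djQuot _ (ModularGroup.T⁻¹ • ψ (x 0))).im
    rw [T_inv_smul_tileInv_of_neg hψ hx, djQuot_slash_negConjPt f hf' h, Complex.conj_im]

/-- **Manin's three-term relation inside the Kontsevich–Zagier calculus (zero-bulk Stokes)**: for a
weight-two cusp form `f` on `Γ₀(N)` with rational Fourier coefficients, `g ∈ SL₂(ℤ)`, `R = TS`, and any
modular-symbol representations `ρ₀, ρ₁, ρ₂` of `⟨g⟩_f, ⟨gR⟩_f, ⟨gR²⟩_f`, the formal sums of the classes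
`[re ⟨g⟩] + [re ⟨gR⟩] + [re ⟨gR²⟩]` and `[im ⟨g⟩] + [im ⟨gR⟩] + [im ⟨gR²⟩]` lie in `KZ.relations`
(value: `⟨g⟩ + ⟨gR⟩ + ⟨gR²⟩ = ∮_{∂(g·(0,∞,1))} ω_f = 0`). Proof: barycentric subdivision of the ideal
triangle into six `(2,3,∞)`-tiles (`classRe/classIm_three_term_of_tiles`) and, for each tile, Cauchy's
theorem in the algebraic coordinate `u = j` derived from the three KZ rules (`tile_cauchy_re/im`,
`mirror_tile_cauchy_re/im`). [cite: Manin1972, §1.6; KontsevichZagierPeriods2001, §1.2, §3.4] -/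
theorem maninStokes_classes (f : CuspForm (Gamma0 N) 2) (hf : HasRatCoeffs f) (g : SL(2, ℤ))
    (ρ₀ : ModularSymbolRep f g) (ρ₁ : ModularSymbolRep f (g * (ModularGroup.T * ModularGroup.S)))
    (ρ₂ : ModularSymbolRep f
      (g * (ModularGroup.T * ModularGroup.S) * (ModularGroup.T * ModularGroup.S))) :
    ρ₀.classRe + ρ₁.classRe + ρ₂.classRe ∈ KZ.relations ∧
      ρ₀.classIm + ρ₁.classIm + ρ₂.classIm ∈ KZ.relations := by
  obtain ⟨ψ, hψ⟩ := exists_tileInv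
  exact ⟨classRe_three_term_of_tiles f g (fun t : ℝ => ψ (t : ℂ)) (fun t : ℝ => ψ (t : ℂ)) ρ₀ ρ₁ ρ₂
      (tile_cauchy_re hψ f hf _) (tile_cauchy_re hψ f hf _) (tile_cauchy_re hψ f hf _)
      (mirror_tile_cauchy_re hψ f hf _) (mirror_tile_cauchy_re hψ f hf _) (mirror_tile_cauchy_re hψ f hf _),
    classIm_three_term_of_tiles f g (fun t : ℝ => ψ (t : ℂ)) (fun t : ℝ => ψ (t : ℂ)) ρ₀ ρ₁ ρ₂
      (tile_cauchy_im hψ f hf _) (tile_cauchy_im hψ f hf _) (tile_cauchy_im hψ f hf _)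
      (mirror_tile_cauchy_im hψ f hf _) (mirror_tile_cauchy_im hψ f hf _) (mirror_tile_cauchy_im hψ f hf _)⟩

omit [NeZero N] in
/-- **`ManinStokes`, the typed form of item `stmt-KontsevichZagierPeriods-5277`** (the route lists the item
as informal-only; this is the statement proposed in the evidence note `ManinStokes-typed.md`): Manin's
three-term relation for the modular-symbol classes of a rational weight-two cusp form holds in the
Kontsevich–Zagier formal period algebra, i.e. modulo `KZ.relations`. (The two-term relation
`[⟨g⟩] + [⟨gS⟩] = 0` is the identity `ModularSymbolRep.classRe_add_classRe_mul_S` of the tree.)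
[cite: Manin1972, §1.6; KontsevichZagierPeriods2001, §1.2, §3.4] -/
theorem maninStokes :
    ∀ (N : ℕ) [NeZero N] (f : CuspForm (Gamma0 N) 2) (g : SL(2, ℤ))
      (ρ₀ : ModularSymbolRep f g) (ρ₁ : ModularSymbolRep f (g * (ModularGroup.T * ModularGroup.S)))
      (ρ₂ : ModularSymbolRep f (g * (ModularGroup.T * ModularGroup.S) * (ModularGroup.T * ModularGroup.S))),
      HasRatCoeffs f →
        ρ₀.classRe + ρ₁.classRe + ρ₂.classRe ∈ Literature.NumberTheory.Transcendental.KZ.relations ∧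
        ρ₀.classIm + ρ₁.classIm + ρ₂.classIm ∈ Literature.NumberTheory.Transcendental.KZ.relations :=
  fun _ _ f g ρ₀ ρ₁ ρ₂ hf => maninStokes_classes f hf g ρ₀ ρ₁ ρ₂

end Assembly


end Summit.KontsevichZagierPeriods.HeckeMultiplicityOne.ManinStokes
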